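import Literature.Probability.Percolation.MultiResTV
import Literature.Probability.Percolation.Crossings
import Literature.Probability.LatticeModels.TriangularLattice
import HarnessLib

/-!
# Multiresolution total variation: the route's instance on boundary-segment matrices

Topic `Probability/Percolation`; second file of definition request `defn-MultiResTV` (route
`CardyGluingRDE`, sub-problem `CardyFormulaZ2`, summit `CriticalPhenomena`), on top of
`MultiResTV.lean` (`tvFin`, `multiResSum`, the generic pseudometric `multiResTV π σ K`).

* `tvDist_map_eq_of_injective`, `weight_mul_tvDist_le_multiResTV_of_injective`,
  `eq_of_multiResTV_eq_zero` — an injective top projection `π K` makes `Dw` dominate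
  `2^{-σ K} Δ(μ, ν)`, so `Dw` is then a genuine metric (generic).
* `dyadicParent K j : Fin (2^K) → Fin (2^j)` — the level-`j` dyadic interval containing a level-`K`
  one (`t ↦ ⌊t / 2^{K-j}⌋` for `j ≤ K`), with `dyadicParent_self` and the tower property
  `dyadicParent_dyadicParent`.
* `SegMatrix k = (Fin 4 × Fin k → Fin 4 × Fin k → Bool)` — the raw resolution-`k` state of a square
  window exactly as the route file inlines it (side, position; entry = "the two boundary segments
  are joined inside the window"), and `SegMatrix.coarsen K j` — OR-fusion of the `2^{K-j}` fine
  segments inside each coarse one (LPSA94 §2.3: "these intervals are then fused in pairs",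
  iterated), with `coarsen_self` and the tower property `coarsen_coarsen`.
* `segMultiResTV σ K = multiResTV (SegMatrix.coarsen K) σ K` on `PMF (SegMatrix (2^K))` — the
  route's metric `Dw`; it separates laws (`eq_of_segMultiResTV_eq_zero`) and dominates
  `2^{-σ K} Δ` (`weight_mul_tvDist_le_segMultiResTV`).
* THE BRIDGE to `Summits/CriticalPhenomena/CardyFormulaZ2/Theses/CardyGluingRDE.lean`:
  `route_TV_eq_tvFin_and_Dw_eq_multiResSum` restates the route's inlined `let`s
  `PZ PT Sq seg EZ ET TV Dw` VERBATIM and proves by `rfl` that its `TV δ₀ j u u'` is `tvFin` of the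
  two reading vectors and its `Dw σ δ₀ K u u'` is `multiResSum σ K` of them;
  `route_Dw_eq_segMultiResTV` then identifies `Dw σ δ₀ K u u'` with `segMultiResTV σ K μ ν` for any
  laws `μ, ν` of the resolution-`2^K` matrix whose OR-coarsenings have those reading vectors as
  coordinates (the content the reading maps of `defn-BoxArcState` are to supply; nothing about
  percolation is proved here).

## References

* R. Langlands, P. Pouliot, Y. Saint-Aubin, *Conformal invariance in two-dimensional percolation*,
  Bull. AMS 30 (1994) 1–61, §2.3 (finite models: states = connection data of boundary intervals;
  fusion of intervals in pairs) [LanglandsPouliotSaintaubin1994].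

## Design and what is NOT here

* States are the route's raw Boolean matrices; the paired (primal, dual) state space, its `D₄` and
  duality actions and the reading maps from percolation configurations are `defn-BoxArcState`.
  `dyadicParent`/`coarsen` are total in `(K, j)`; only `j ≤ K` is meaningful (for `j > K`,
  `dyadicParent` is the harmless refinement `t ↦ t · 2^{j-K}`), and `multiResTV` never looks there.
-/

noncomputable section

open scoped ENNReal

namespace Literature.Probability.Percolation

/-! ### Injective top projections: `Dw` is a metric -/

section Injective

variable {S : Type*} {T : ℕ → Type*} (π : (j : ℕ) → S → T j) (σ : ℝ) (K : ℕ)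

/-- Push-forward along an injective map preserves the statistical distance. [folklore] -/
theorem tvDist_map_eq_of_injective {β : Type*} {f : S → β} (hf : Function.Injective f)
    (p q : PMF S) : (p.map f).tvDist (q.map f) = p.tvDist q := by
  classical
  have key : ∀ (r : PMF S) (a : S), r.map f (f a) = r a := fun r a => by
    rw [PMF.map_apply]
    exact (tsum_eq_single a fun a' h => if_neg fun e => h (hf e).symm).trans (if_pos rfl)
  have off : ∀ (r : PMF S) (b : β), b ∉ Set.range f → r.map f b = 0 := fun r b hb => by
    rw [PMF.map_apply, ENNReal.tsum_eq_zero]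
    exact fun a => if_neg fun e => hb ⟨a, e.symm⟩
  unfold PMF.tvDist
  congr 1
  have hsupp : (Function.support fun b => |(p.map f b).toReal - (q.map f b).toReal|) ⊆
      Set.range f := by
    intro b hb
    by_contra hb'
    exact hb (by simp [off p b hb', off q b hb'])
  rw [← hf.tsum_eq hsupp]
  simp only [key]

/-- **At an injective top projection `Dw` dominates total variation**:
`2^{-σ K} Δ(μ, ν) ≤ Dw(μ, ν)` when `π K` is injective (e.g. the identity coarsening at the top
resolution). [folklore] -/
theorem weight_mul_tvDist_le_multiResTV_of_injective (hK : Function.Injective (π K)) (μ ν : PMF S) :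
    multiResWeight σ K * μ.tvDist ν ≤ multiResTV π σ K μ ν := by
  rw [← tvDist_map_eq_of_injective hK]
  exact weight_mul_tvDist_le_multiResTV π σ K le_rfl μ ν

/-- Hence `Dw` is a genuine METRIC when the top projection is injective: `Dw(μ, ν) = 0 → μ = ν`.
[folklore] -/
theorem eq_of_multiResTV_eq_zero (hK : Function.Injective (π K)) {μ ν : PMF S}
    (h : multiResTV π σ K μ ν = 0) : μ = ν := by
  have h0 : μ.tvDist ν = 0 := by
    refine le_antisymm ?_ (PMF.tvDist_nonneg _ _)
    have := weight_mul_tvDist_le_multiResTV_of_injective π σ K hK μ ν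
    rw [h, ← mul_zero (multiResWeight σ K)] at this
    exact le_of_mul_le_mul_left this (multiResWeight_pos σ K)
  -- `Δ(μ, ν) = 0` forces `μ = ν` (a sum of nonnegative terms vanishes termwise).
  have hs : HasSum (fun a => |(μ a).toReal - (ν a).toReal|) 0 := by
    have h2 : ∑' a, |(μ a).toReal - (ν a).toReal| = 0 := by
      have : (2 : ℝ)⁻¹ * ∑' a, |(μ a).toReal - (ν a).toReal| = 0 := h0
      simpa using this
    rw [← h2]
    exact (PMF.summable_abs_toReal_sub_toReal μ ν).hasSum
  have hf := (hasSum_zero_iff_of_nonneg fun a => abs_nonneg _).1 hs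
  refine PMF.ext fun a => ?_
  have ha : |(μ a).toReal - (ν a).toReal| = 0 := congrFun hf a
  rw [abs_eq_zero, sub_eq_zero] at ha
  exact (ENNReal.toReal_eq_toReal_iff' (PMF.apply_ne_top μ a) (PMF.apply_ne_top ν a)).1 ha

end Injective

/-! ### The route's instance: dyadic coarsening of boundary-segment matrices -/

/-- **Dyadic coarsening of positions**: the level-`j` dyadic interval containing the `t`-th level-`K`
interval of a side, `t ↦ ⌊t · 2^j / 2^K⌋` (`= ⌊t / 2^{K-j}⌋` for `j ≤ K`, `dyadicParent_val_of_le`; for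
`j > K` the harmless refinement `t ↦ t · 2^{j-K}`, never used). [folklore] -/
def dyadicParent (K j : ℕ) (t : Fin (2 ^ K)) : Fin (2 ^ j) :=
  ⟨t.val * 2 ^ j / 2 ^ K, by
    rw [Nat.div_lt_iff_lt_mul (Nat.two_pow_pos K), mul_comm (2 ^ j) (2 ^ K)]
    exact mul_lt_mul_of_pos_right t.isLt (Nat.two_pow_pos j)⟩

/-- The value of `dyadicParent`. [folklore] -/
theorem dyadicParent_val (K j : ℕ) (t : Fin (2 ^ K)) :
    (dyadicParent K j t).val = t.val * 2 ^ j / 2 ^ K := rfl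

/-- For `j ≤ K`: `dyadicParent K j t = ⌊t / 2^{K-j}⌋` (blocks of `2^{K-j}` consecutive fine segments).
[folklore] -/
theorem dyadicParent_val_of_le {K j : ℕ} (h : j ≤ K) (t : Fin (2 ^ K)) :
    (dyadicParent K j t).val = t.val / 2 ^ (K - j) := by
  rw [dyadicParent_val]
  obtain ⟨n, rfl⟩ := Nat.exists_eq_add_of_le h
  generalize t.val = m
  rw [Nat.add_sub_cancel_left, pow_add, mul_comm (2 ^ j) (2 ^ n)]
  exact Nat.mul_div_mul_right _ _ (Nat.two_pow_pos j)

/-- At the top level the coarsening is the identity. [folklore] -/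
@[simp] theorem dyadicParent_self (K : ℕ) (t : Fin (2 ^ K)) : dyadicParent K K t = t :=
  Fin.ext (by rw [dyadicParent_val, Nat.mul_div_cancel _ (Nat.two_pow_pos K)])

/-- **Tower property**: coarsening `K → j'` and then `j' → j` is coarsening `K → j`
(`j ≤ j' ≤ K`). [folklore] -/
theorem dyadicParent_dyadicParent {K j' j : ℕ} (hj : j ≤ j') (hj' : j' ≤ K) (t : Fin (2 ^ K)) :
    dyadicParent j' j (dyadicParent K j' t) = dyadicParent K j t := by
  refine Fin.ext ?_
  rw [dyadicParent_val_of_le hj, dyadicParent_val_of_le hj', dyadicParent_val_of_le (hj.trans hj'),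
    Nat.div_div_eq_div_mul, ← pow_add]
  congr 2
  omega

/-- **The raw resolution-`k` state of a square window in the route file**: Boolean matrices indexed
by the `4k` boundary segments `Fin 4 × Fin k` (side, position) — entry `(a, b)` reads "segments `a`
and `b` are joined inside the window" (the route inlines exactly
`(Fin 4 × Fin (2 ^ j)) → (Fin 4 × Fin (2 ^ j)) → Bool`; Langlands' finite-model states `A` are such
connection data, LPSA94 §2.3). [cite: LanglandsPouliotSaintaubin1994, §2.3] -/
abbrev SegMatrix (k : ℕ) : Type := (Fin 4 × Fin k) → (Fin 4 × Fin k) → Bool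

namespace SegMatrix

/-- **OR-fusion coarsening of a segment matrix** from `2^K` to `2^j` segments per side: coarse
segments `a`, `b` are joined iff SOME fine segment inside `a` is joined to SOME fine segment
inside `b` ("these intervals are then fused in pairs", LPSA94 §2.3, iterated `K − j` times).
[cite: LanglandsPouliotSaintaubin1994, §2.3] -/
def coarsen (K j : ℕ) (M : SegMatrix (2 ^ K)) : SegMatrix (2 ^ j) := fun a b =>
  decide (∃ s t : Fin (2 ^ K), dyadicParent K j s = a.2 ∧ dyadicParent K j t = b.2 ∧
    M (a.1, s) (b.1, t) = true)

/-- The coarse entry is `true` iff some pair of fine segments below it is joined. [folklore] -/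
theorem coarsen_apply_eq_true_iff (K j : ℕ) (M : SegMatrix (2 ^ K)) (a b : Fin 4 × Fin (2 ^ j)) :
    coarsen K j M a b = true ↔ ∃ s t : Fin (2 ^ K), dyadicParent K j s = a.2 ∧
      dyadicParent K j t = b.2 ∧ M (a.1, s) (b.1, t) = true := by
  rw [coarsen, decide_eq_true_iff]

/-- Coarsening to the same resolution is the identity. [folklore] -/
@[simp] theorem coarsen_self (K : ℕ) (M : SegMatrix (2 ^ K)) : coarsen K K M = M := by
  funext a b
  refine Bool.eq_iff_iff.2 ?_
  rw [coarsen_apply_eq_true_iff]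
  simp only [dyadicParent_self]
  constructor
  · rintro ⟨s, t, rfl, rfl, h⟩
    exact h
  · exact fun h => ⟨a.2, b.2, rfl, rfl, h⟩

/-- **Tower property of OR-fusion**: coarsening `K → j'` then `j' → j` equals coarsening `K → j`
(`j ≤ j' ≤ K`) — the levels of `segMultiResTV` are consistent. [folklore] -/
theorem coarsen_coarsen {K j' j : ℕ} (hj : j ≤ j') (hj' : j' ≤ K) (M : SegMatrix (2 ^ K)) :
    coarsen j' j (coarsen K j' M) = coarsen K j M := by
  funext a b
  refine Bool.eq_iff_iff.2 ?_
  simp only [coarsen_apply_eq_true_iff]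
  constructor
  · rintro ⟨s', t', hs', ht', s, t, hs, ht, h⟩
    refine ⟨s, t, ?_, ?_, h⟩
    · rw [← dyadicParent_dyadicParent hj hj', hs, hs']
    · rw [← dyadicParent_dyadicParent hj hj', ht, ht']
  · rintro ⟨s, t, hs, ht, h⟩
    exact ⟨dyadicParent K j' s, dyadicParent K j' t, by rw [dyadicParent_dyadicParent hj hj', hs],
      by rw [dyadicParent_dyadicParent hj hj', ht], s, t, rfl, rfl, h⟩

end SegMatrix

/-- **The route's multiresolution metric on laws of resolution-`2^K` segment matrices**:
`segMultiResTV σ K μ ν = ∑_{j ≤ K} 2^{-σ j} Δ(μ.map (coarsen K j), ν.map (coarsen K j))`.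
All of the `multiResTV` API applies; the top projection `coarsen K K = id` is injective, so this is
a metric (`eq_of_segMultiResTV_eq_zero`). [folklore] -/
abbrev segMultiResTV (σ : ℝ) (K : ℕ) (μ ν : PMF (SegMatrix (2 ^ K))) : ℝ :=
  multiResTV (SegMatrix.coarsen K) σ K μ ν

/-- `2^{-σ K} Δ(μ, ν) ≤ segMultiResTV σ K μ ν ≤ (∑_{j ≤ K} 2^{-σ j}) Δ(μ, ν)`: at fixed `K` the route's
metric is equivalent to total variation (so uniformity in `K` is the content of a contraction
claim). [folklore] -/
theorem weight_mul_tvDist_le_segMultiResTV (σ : ℝ) (K : ℕ) (μ ν : PMF (SegMatrix (2 ^ K))) :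
    multiResWeight σ K * μ.tvDist ν ≤ segMultiResTV σ K μ ν :=
  weight_mul_tvDist_le_multiResTV_of_injective _ σ K
    (fun M M' h => by simpa only [SegMatrix.coarsen_self] using h) μ ν

/-- The route's metric separates laws: `segMultiResTV σ K μ ν = 0 → μ = ν`. [folklore] -/
theorem eq_of_segMultiResTV_eq_zero {σ : ℝ} {K : ℕ} {μ ν : PMF (SegMatrix (2 ^ K))}
    (h : segMultiResTV σ K μ ν = 0) : μ = ν :=
  eq_of_multiResTV_eq_zero _ σ K (fun M M' h => by simpa only [SegMatrix.coarsen_self] using h) h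

/-! ### Bridge to the route file's inlined `TV` / `Dw` -/

/-- **Bridge to the route file (verbatim).** With `PZ, PT, Sq, seg, EZ, ET, TV, Dw` literally the
`let`s of `GluingContraction` / `BoxMerging` / `ContractionGivesMerging` in
`Summits/CriticalPhenomena/CardyFormulaZ2/Theses/CardyGluingRDE.lean` (rev 0, 2026-08-15): the
inlined `TV δ₀ j u u'` IS `tvFin` of the two reading vectors `M ↦ PZ.real (EZ δ₀ j u M)` (bond-`ℤ²`,
mesh `u`) and `M ↦ PT.real (ET δ₀ j u' M)` (site-`𝕋`, mesh `u'`) on `SegMatrix (2^j)`, and the inlined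
`Dw σ δ₀ K u u'` IS `multiResSum σ K` of these — both by `rfl`. [folklore] -/
theorem route_TV_eq_tvFin_and_Dw_eq_multiResSum :
    let PZ := Literature.Probability.Percolation.bondPercolation
      (Literature.Probability.LatticeModels.zdGraph 2) Literature.Probability.Percolation.half
    let PT := Literature.Probability.LatticeModels.triSitePercolation
      Literature.Probability.Percolation.half
    let Sq : ℝ → Set ℂ := fun δ₀ => {z : ℂ | 0 < z.re ∧ z.re < δ₀ ∧ 0 < z.im ∧ z.im < δ₀}
    let seg : (δ₀ : ℝ) → (j : ℕ) → Fin 4 × Fin (2 ^ j) → Set ℂ := fun δ₀ j a =>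
      {z : ℂ | (a.1 = 0 ∧ z.im = 0 ∧ δ₀ * ((a.2 : ℕ) : ℝ) / 2 ^ j ≤ z.re ∧
          z.re ≤ δ₀ * (((a.2 : ℕ) : ℝ) + 1) / 2 ^ j) ∨
        (a.1 = 1 ∧ z.re = δ₀ ∧ δ₀ * ((a.2 : ℕ) : ℝ) / 2 ^ j ≤ z.im ∧
          z.im ≤ δ₀ * (((a.2 : ℕ) : ℝ) + 1) / 2 ^ j) ∨
        (a.1 = 2 ∧ z.im = δ₀ ∧ δ₀ * ((a.2 : ℕ) : ℝ) / 2 ^ j ≤ z.re ∧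
          z.re ≤ δ₀ * (((a.2 : ℕ) : ℝ) + 1) / 2 ^ j) ∨
        (a.1 = 3 ∧ z.re = 0 ∧ δ₀ * ((a.2 : ℕ) : ℝ) / 2 ^ j ≤ z.im ∧
          z.im ≤ δ₀ * (((a.2 : ℕ) : ℝ) + 1) / 2 ^ j)}
    let EZ : (δ₀ : ℝ) → (j : ℕ) → ℝ → ((Fin 4 × Fin (2 ^ j)) → (Fin 4 × Fin (2 ^ j)) → Bool) →
        Set (Literature.Probability.Percolation.BondConfig
          (Literature.Probability.LatticeModels.Site 2)) := fun δ₀ j u M =>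
      {ω | ∀ a b, ω ∈ Literature.Probability.Percolation.discreteCrossing (Sq δ₀) u (seg δ₀ j a)
        (seg δ₀ j b) ↔ M a b = true}
    let ET : (δ₀ : ℝ) → (j : ℕ) → ℝ → ((Fin 4 × Fin (2 ^ j)) → (Fin 4 × Fin (2 ^ j)) → Bool) →
        Set (Literature.Probability.Percolation.SiteConfig
          (Literature.Probability.LatticeModels.Site 2)) := fun δ₀ j u M =>
      {ω | ∀ a b, ω ∈ Literature.Probability.LatticeModels.triCrossing (Sq δ₀) u (seg δ₀ j a)
        (seg δ₀ j b) ↔ M a b = true}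
    let TV : ℝ → ℕ → ℝ → ℝ → ℝ := fun δ₀ j u u' => (1 / 2 : ℝ) *
      ∑ M : (Fin 4 × Fin (2 ^ j)) → (Fin 4 × Fin (2 ^ j)) → Bool,
        |PZ.real (EZ δ₀ j u M) - PT.real (ET δ₀ j u' M)|
    let Dw : ℝ → ℝ → ℕ → ℝ → ℝ → ℝ := fun σ δ₀ K u u' =>
      ∑ j ∈ Finset.range (K + 1), (2 : ℝ) ^ (-(σ * (j : ℝ))) * TV δ₀ j u u'
    (∀ (δ₀ : ℝ) (j : ℕ) (u u' : ℝ), TV δ₀ j u u' =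
        tvFin (fun M => PZ.real (EZ δ₀ j u M)) (fun M => PT.real (ET δ₀ j u' M))) ∧
    (∀ (σ δ₀ : ℝ) (K : ℕ) (u u' : ℝ), Dw σ δ₀ K u u' = multiResSum σ K
        (fun j => tvFin (fun M => PZ.real (EZ δ₀ j u M)) (fun M => PT.real (ET δ₀ j u' M)))) :=
  ⟨fun _ _ _ _ => rfl, fun _ _ _ _ _ => rfl⟩

/-- **The route's `Dw` is `segMultiResTV` on reading laws.** Same verbatim `let`s. If
`μ, ν : PMF (SegMatrix (2^K))` are laws of the resolution-`2^K` matrix whose OR-coarsenings to every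
level `j ≤ K` have the route's reading vectors as coordinates —
`(μ.map (coarsen K j) M).toReal = PZ.real (EZ δ₀ j u M)` (bond-`ℤ²`, mesh `u`) and
`(ν.map (coarsen K j) M).toReal = PT.real (ET δ₀ j u' M)` (site-`𝕋`, mesh `u'`); this is what the
reading maps of `defn-BoxArcState` and the exactness of OR-fusion are to provide — then
`Dw σ δ₀ K u u' = segMultiResTV σ K μ ν`. [folklore] -/
theorem route_Dw_eq_segMultiResTV :
    let PZ := Literature.Probability.Percolation.bondPercolation
      (Literature.Probability.LatticeModels.zdGraph 2) Literature.Probability.Percolation.half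
    let PT := Literature.Probability.LatticeModels.triSitePercolation
      Literature.Probability.Percolation.half
    let Sq : ℝ → Set ℂ := fun δ₀ => {z : ℂ | 0 < z.re ∧ z.re < δ₀ ∧ 0 < z.im ∧ z.im < δ₀}
    let seg : (δ₀ : ℝ) → (j : ℕ) → Fin 4 × Fin (2 ^ j) → Set ℂ := fun δ₀ j a =>
      {z : ℂ | (a.1 = 0 ∧ z.im = 0 ∧ δ₀ * ((a.2 : ℕ) : ℝ) / 2 ^ j ≤ z.re ∧
          z.re ≤ δ₀ * (((a.2 : ℕ) : ℝ) + 1) / 2 ^ j) ∨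
        (a.1 = 1 ∧ z.re = δ₀ ∧ δ₀ * ((a.2 : ℕ) : ℝ) / 2 ^ j ≤ z.im ∧
          z.im ≤ δ₀ * (((a.2 : ℕ) : ℝ) + 1) / 2 ^ j) ∨
        (a.1 = 2 ∧ z.im = δ₀ ∧ δ₀ * ((a.2 : ℕ) : ℝ) / 2 ^ j ≤ z.re ∧
          z.re ≤ δ₀ * (((a.2 : ℕ) : ℝ) + 1) / 2 ^ j) ∨
        (a.1 = 3 ∧ z.re = 0 ∧ δ₀ * ((a.2 : ℕ) : ℝ) / 2 ^ j ≤ z.im ∧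
          z.im ≤ δ₀ * (((a.2 : ℕ) : ℝ) + 1) / 2 ^ j)}
    let EZ : (δ₀ : ℝ) → (j : ℕ) → ℝ → ((Fin 4 × Fin (2 ^ j)) → (Fin 4 × Fin (2 ^ j)) → Bool) →
        Set (Literature.Probability.Percolation.BondConfig
          (Literature.Probability.LatticeModels.Site 2)) := fun δ₀ j u M =>
      {ω | ∀ a b, ω ∈ Literature.Probability.Percolation.discreteCrossing (Sq δ₀) u (seg δ₀ j a)
        (seg δ₀ j b) ↔ M a b = true}
    let ET : (δ₀ : ℝ) → (j : ℕ) → ℝ → ((Fin 4 × Fin (2 ^ j)) → (Fin 4 × Fin (2 ^ j)) → Bool) →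
        Set (Literature.Probability.Percolation.SiteConfig
          (Literature.Probability.LatticeModels.Site 2)) := fun δ₀ j u M =>
      {ω | ∀ a b, ω ∈ Literature.Probability.LatticeModels.triCrossing (Sq δ₀) u (seg δ₀ j a)
        (seg δ₀ j b) ↔ M a b = true}
    let TV : ℝ → ℕ → ℝ → ℝ → ℝ := fun δ₀ j u u' => (1 / 2 : ℝ) *
      ∑ M : (Fin 4 × Fin (2 ^ j)) → (Fin 4 × Fin (2 ^ j)) → Bool,
        |PZ.real (EZ δ₀ j u M) - PT.real (ET δ₀ j u' M)|
    let Dw : ℝ → ℝ → ℕ → ℝ → ℝ → ℝ := fun σ δ₀ K u u' =>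
      ∑ j ∈ Finset.range (K + 1), (2 : ℝ) ^ (-(σ * (j : ℝ))) * TV δ₀ j u u'
    ∀ (σ δ₀ : ℝ) (K : ℕ) (u u' : ℝ) (μ ν : PMF (SegMatrix (2 ^ K))),
      (∀ j ≤ K, ∀ M, (μ.map (SegMatrix.coarsen K j) M).toReal = PZ.real (EZ δ₀ j u M)) →
      (∀ j ≤ K, ∀ M, (ν.map (SegMatrix.coarsen K j) M).toReal = PT.real (ET δ₀ j u' M)) →
      Dw σ δ₀ K u u' = segMultiResTV σ K μ ν := by
  intro PZ PT Sq seg EZ ET TV Dw σ δ₀ K u u' μ ν hμ hν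
  exact multiResSum_tvFin_eq_multiResTV (SegMatrix.coarsen K) σ K hμ hν

end Literature.Probability.Percolation

end
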